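import Summits.CriticalPhenomena.PercolationContinuityZ3.Theorems.PercNearOneGluingNoHeavyLowerTailSahiCTCRtThreeAtoms
import HarnessLib

/-!
# `NoHeavyLowerTail` (crux stmt-CriticalPhenomena-4575), P3 lane: the remaining CORNER SUMS of the single-step atoms, and the weighted atom
# sum as a bilinear form `Σ_{S,S'} [S ∈ 𝒳][S' ∈ 𝒵]·sepE(type)` (memo g49 §3; third of four proof files; definitions in `…RtThreeSepDefs`)

Support file (seat `prim-l12-p3`, gen 49; `--supports stmt-CriticalPhenomena-4575`).  Memo
`run/shared/lean/prim/prim-l12/FROM-prim-l12-p3-g49-SEPARABLE-CERTIFICATES.md` §3.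

* `corner_three` (`u` inserted on the left), `corner_four` (both points inserted);
* **`atomSum_eq_sum_sepE`** : `Σ_atoms Ω·Δx·Δz = Σ_{S,S' ⊆ V} [S ∈ 𝒳][S' ∈ 𝒵]·sepE(type of (S,S'), #(V ∖ (S ∪ S')))` — the four corners
  with signs `+ − − +`.
Nothing is asserted about the crux.
-/

noncomputable section

open scoped Classical

namespace Summit.CriticalPhenomena.PercolationContinuityZ3.Theorems.SahiCTCForms

open Finset MvPolynomial SahiCTCGenFun

variable {α : Type*} [DecidableEq α] [Fintype α]

/-! ### The last two corners -/

section Corners3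
variable (wJ wX wOx wOz wOO : ℕ → ℕ → ℕ → ℚ)

omit [Fintype α] in
/-- Corner `(A, B+v) = (S, S')` (`u ∉ S` inserted on the left). [this work] -/
theorem corner_three (V S S' : Finset α) (hS' : S' ⊆ V) :
    ∑ u ∈ V \ S, ∑ v ∈ S', atomΩ wJ wX wOx wOz wOO (insert u S) u S' v =
      (#(S' \ S) : ℚ) * wJ (#(S ∩ S') + 1) #(S \ S') (#(S' \ S) - 1)
      + #(S ∩ S') * #(S' \ S) * wX (#(S ∩ S') + 1) #(S \ S') (#(S' \ S) - 1)
      + (#(S' \ S) * #(S' \ S) - #(S' \ S)) * wOz (#(S ∩ S') + 1) #(S \ S') (#(S' \ S) - 1)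
      + #(S ∩ S') * #(V \ (S ∪ S')) * wOx #(S ∩ S') (#(S \ S') + 1) #(S' \ S)
      + #(S' \ S) * #(V \ (S ∪ S')) * wOO #(S ∩ S') (#(S \ S') + 1) #(S' \ S) := by
  set a := #(S ∩ S'); set b := #(S \ S'); set c := #(S' \ S); set o := #(V \ (S ∪ S'))
  set Ω := fun u v => atomΩ wJ wX wOx wOz wOO (insert u S) u S' v with hΩ
  have hS'd : S' = S ∩ S' ∪ S' \ S := by rw [inter_comm, union_comm, sdiff_union_inter]
  have hdS' : Disjoint (S ∩ S') (S' \ S) := by rw [inter_comm]; exact (disjoint_sdiff_inter S' S).symm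
  have hVd : V \ S = S' \ S ∪ V \ (S ∪ S') := by rw [union_comm S S']; exact sdiff_eq_sdiff_union_sdiff_union hS'
  have hdV : Disjoint (S' \ S) (V \ (S ∪ S')) := by rw [union_comm S S']; exact disjoint_sdiff_sdiff_union V S' S
  have typQ : ∀ u ∈ S' \ S, #(insert u S ∩ S') = a + 1 ∧ #(insert u S \ S') = b ∧ #(S' \ insert u S) = c - 1 := by
    intro u hu
    obtain ⟨huS', huS⟩ := mem_sdiff.1 hu
    refine ⟨by rw [card_insert_inter_left huS, if_pos huS'], by rw [card_insert_sdiff_left huS, if_pos huS', add_zero], ?_⟩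
    have := card_sdiff_insert_left (S' := S') huS; rw [if_pos huS'] at this; omega
  have typO : ∀ u ∈ V \ (S ∪ S'), #(insert u S ∩ S') = a ∧ #(insert u S \ S') = b + 1 ∧ #(S' \ insert u S) = c := by
    intro u hu
    have huS : u ∉ S := fun h => (mem_sdiff.1 hu).2 (mem_union_left _ h)
    have huS' : u ∉ S' := fun h => (mem_sdiff.1 hu).2 (mem_union_right _ h)
    refine ⟨by rw [card_insert_inter_left huS, if_neg huS', add_zero], by rw [card_insert_sdiff_left huS, if_neg huS'], ?_⟩
    have := card_sdiff_insert_left (S' := S') huS; rw [if_neg huS'] at this; omega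
  show ∑ u ∈ V \ S, ∑ v ∈ S', Ω u v = _
  rw [hVd, sum_union hdV]
  have hsplit : ∀ u, ∑ v ∈ S', Ω u v = ∑ v ∈ S ∩ S', Ω u v + ∑ v ∈ S' \ S, Ω u v := fun u => by
    conv_lhs => rw [hS'd]
    rw [sum_union hdS']
  simp_rw [hsplit, sum_add_distrib]
  have hQI : ∑ u ∈ S' \ S, ∑ v ∈ S ∩ S', Ω u v = c * a * wX (a + 1) b (c - 1) := by
    refine sum_sum_const_of_eq fun u hu v hv => ?_
    obtain ⟨t1, t2, t3⟩ := typQ u hu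
    have huS' : u ∈ S' := (mem_sdiff.1 hu).1
    have huv : u ≠ v := fun h => (mem_sdiff.1 hu).2 (h ▸ (mem_inter.1 hv).1)
    rw [hΩ]; dsimp only
    rw [atomΩ_X _ _ _ _ _ huv huS' (mem_insert_of_mem (mem_inter.1 hv).1), t1, t2, t3]
  have hQQ : ∑ u ∈ S' \ S, ∑ v ∈ S' \ S, Ω u v = c * wJ (a + 1) b (c - 1) + (c * c - c) * wOz (a + 1) b (c - 1) := by
    refine sum_sum_diag_of_eq (fun u hu => ?_) (fun u hu v hv huv => ?_)
    · obtain ⟨t1, t2, t3⟩ := typQ u hu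
      rw [hΩ]; dsimp only; rw [atomΩ_J _ _ _ _ _ rfl, t1, t2, t3]
    · obtain ⟨t1, t2, t3⟩ := typQ u hu
      have hvS : v ∉ insert u S := fun h => by
        rcases mem_insert.1 h with h | h
        · exact huv h.symm
        · exact (mem_sdiff.1 hv).2 h
      rw [hΩ]; dsimp only; rw [atomΩ_Oz _ _ _ _ _ huv hvS (mem_sdiff.1 hu).1, t1, t2, t3]
  have hOI : ∑ u ∈ V \ (S ∪ S'), ∑ v ∈ S ∩ S', Ω u v = o * a * wOx a (b + 1) c := by
    refine sum_sum_const_of_eq fun u hu v hv => ?_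
    obtain ⟨t1, t2, t3⟩ := typO u hu
    have huS' : u ∉ S' := fun h => (mem_sdiff.1 hu).2 (mem_union_right _ h)
    have huv : u ≠ v := fun h => huS' (h ▸ (mem_inter.1 hv).2)
    rw [hΩ]; dsimp only
    rw [atomΩ_Ox _ _ _ _ _ huv huS' (mem_insert_of_mem (mem_inter.1 hv).1), t1, t2, t3]
  have hOQ : ∑ u ∈ V \ (S ∪ S'), ∑ v ∈ S' \ S, Ω u v = o * c * wOO a (b + 1) c := by
    refine sum_sum_const_of_eq fun u hu v hv => ?_
    obtain ⟨t1, t2, t3⟩ := typO u hu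
    have huS' : u ∉ S' := fun h => (mem_sdiff.1 hu).2 (mem_union_right _ h)
    have huv : u ≠ v := fun h => huS' (h ▸ (mem_sdiff.1 hv).1)
    have hvS : v ∉ insert u S := fun h => by
      rcases mem_insert.1 h with h | h
      · exact huv h.symm
      · exact (mem_sdiff.1 hv).2 h
    rw [hΩ]; dsimp only
    rw [atomΩ_OO _ _ _ _ _ huv huS' hvS, t1, t2, t3]
  rw [hQI, hQQ, hOI, hOQ]
  ring

omit [Fintype α] in
/-- Corner `(A, B) = (S, S')` (both points inserted). [this work] -/
theorem corner_four (V S S' : Finset α) (hS : S ⊆ V) (hS' : S' ⊆ V) :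
    ∑ u ∈ V \ S, ∑ v ∈ V \ S', atomΩ wJ wX wOx wOz wOO (insert u S) u (insert v S') v =
      (#(S \ S') : ℚ) * #(S' \ S) * wX (#(S ∩ S') + 2) (#(S \ S') - 1) (#(S' \ S) - 1)
      + #(S' \ S) * #(V \ (S ∪ S')) * wOz (#(S ∩ S') + 1) #(S \ S') #(S' \ S)
      + #(S \ S') * #(V \ (S ∪ S')) * wOx (#(S ∩ S') + 1) #(S \ S') #(S' \ S)
      + #(V \ (S ∪ S')) * wJ (#(S ∩ S') + 1) #(S \ S') #(S' \ S)
      + (#(V \ (S ∪ S')) * #(V \ (S ∪ S')) - #(V \ (S ∪ S'))) * wOO #(S ∩ S') (#(S \ S') + 1) (#(S' \ S) + 1) := by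
  set a := #(S ∩ S'); set b := #(S \ S'); set c := #(S' \ S); set o := #(V \ (S ∪ S'))
  set Ω := fun u v => atomΩ wJ wX wOx wOz wOO (insert u S) u (insert v S') v with hΩ
  have hVS : V \ S = S' \ S ∪ V \ (S ∪ S') := by rw [union_comm S S']; exact sdiff_eq_sdiff_union_sdiff_union hS'
  have hdVS : Disjoint (S' \ S) (V \ (S ∪ S')) := by rw [union_comm S S']; exact disjoint_sdiff_sdiff_union V S' S
  have hVS' : V \ S' = S \ S' ∪ V \ (S ∪ S') := sdiff_eq_sdiff_union_sdiff_union hS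
  have hdVS' : Disjoint (S \ S') (V \ (S ∪ S')) := disjoint_sdiff_sdiff_union V S S'
  have memO : ∀ x ∈ V \ (S ∪ S'), x ∉ S ∧ x ∉ S' := fun x hx =>
    ⟨fun h => (mem_sdiff.1 hx).2 (mem_union_left _ h), fun h => (mem_sdiff.1 hx).2 (mem_union_right _ h)⟩
  -- the three cardinalities of (insert u S, insert v S') for u ∉ S, v ∉ S', u ≠ v, in terms of [u ∈ S'], [v ∈ S]
  have card3 : ∀ u v, u ∉ S → v ∉ S' → u ≠ v →
      #(insert u S ∩ insert v S') = a + (if u ∈ S' then 1 else 0) + (if v ∈ S then 1 else 0) ∧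
      #(insert u S \ insert v S') + (if v ∈ S then 1 else 0) = b + (if u ∈ S' then 0 else 1) ∧
      #(insert v S' \ insert u S) + (if u ∈ S' then 1 else 0) = c + (if v ∈ S then 0 else 1) := by
    intro u v hu hv huv
    have hu' : (u ∈ insert v S') ↔ u ∈ S' := by rw [mem_insert]; exact ⟨fun h => h.resolve_left huv, Or.inr⟩
    have hv' : (v ∈ insert u S) ↔ v ∈ S := by rw [mem_insert]; exact ⟨fun h => h.resolve_left (Ne.symm huv), Or.inr⟩
    refine ⟨?_, ?_, ?_⟩
    · rw [card_insert_inter_left hu, card_inter_insert_right hv, if_congr hu' rfl rfl]; ring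
    · have h1 := card_sdiff_insert_right (S := insert u S) hv
      rw [card_insert_sdiff_left (S' := S') hu, if_congr hv' rfl rfl] at h1; omega
    · have h1 := card_sdiff_insert_left (S' := insert v S') hu
      rw [card_insert_sdiff_right (S := S) hv, if_congr hu' rfl rfl] at h1; omega
  -- diagonal (u = v ∈ O)
  have cardD : ∀ u, u ∉ S → u ∉ S' →
      #(insert u S ∩ insert u S') = a + 1 ∧ #(insert u S \ insert u S') = b ∧ #(insert u S' \ insert u S) = c := by
    intro u hu hu'
    refine ⟨?_, ?_, ?_⟩
    · rw [card_insert_inter_left hu, card_inter_insert_right hu', if_pos (mem_insert_self u S'), if_neg hu]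
    · have h1 := card_sdiff_insert_right (S := insert u S) hu'
      rw [card_insert_sdiff_left (S' := S') hu, if_pos (mem_insert_self u S), if_neg hu'] at h1; omega
    · have h1 := card_sdiff_insert_left (S' := insert u S') hu
      rw [card_insert_sdiff_right (S := S) hu', if_pos (mem_insert_self u S'), if_neg hu] at h1; omega
  show ∑ u ∈ V \ S, ∑ v ∈ V \ S', Ω u v = _
  rw [hVS, sum_union hdVS]
  have hsplit : ∀ u, ∑ v ∈ V \ S', Ω u v = ∑ v ∈ S \ S', Ω u v + ∑ v ∈ V \ (S ∪ S'), Ω u v := fun u => by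
    rw [hVS', sum_union hdVS']
  simp_rw [hsplit, sum_add_distrib]
  have hQP : ∑ u ∈ S' \ S, ∑ v ∈ S \ S', Ω u v = c * b * wX (a + 2) (b - 1) (c - 1) := by
    refine sum_sum_const_of_eq fun u hu v hv => ?_
    obtain ⟨huS', huS⟩ := mem_sdiff.1 hu
    obtain ⟨hvS, hvS'⟩ := mem_sdiff.1 hv
    have huv : u ≠ v := fun h => huS (h ▸ hvS)
    obtain ⟨t1, t2, t3⟩ := card3 u v huS hvS' huv
    rw [if_pos huS', if_pos hvS] at t1 t2 t3
    rw [hΩ]; dsimp only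
    have e2 : #(insert u S \ insert v S') = b - 1 := by omega
    have e3 : #(insert v S' \ insert u S) = c - 1 := by omega
    rw [atomΩ_X _ _ _ _ _ huv (mem_insert_of_mem huS') (mem_insert_of_mem hvS), t1, e2, e3]
  have hQO : ∑ u ∈ S' \ S, ∑ v ∈ V \ (S ∪ S'), Ω u v = c * o * wOz (a + 1) b c := by
    refine sum_sum_const_of_eq fun u hu v hv => ?_
    obtain ⟨huS', huS⟩ := mem_sdiff.1 hu
    obtain ⟨hvS, hvS'⟩ := memO v hv
    have huv : u ≠ v := fun h => hvS' (h ▸ huS')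
    obtain ⟨t1, t2, t3⟩ := card3 u v huS hvS' huv
    rw [if_pos huS', if_neg hvS] at t1 t2 t3
    have hvS2 : v ∉ insert u S := fun h => by
      rcases mem_insert.1 h with h | h
      · exact huv h.symm
      · exact hvS h
    rw [hΩ]; dsimp only
    have e2 : #(insert u S \ insert v S') = b := by omega
    have e3 : #(insert v S' \ insert u S) = c := by omega
    rw [atomΩ_Oz _ _ _ _ _ huv hvS2 (mem_insert_of_mem huS'), t1, e2, e3]
  have hOP : ∑ u ∈ V \ (S ∪ S'), ∑ v ∈ S \ S', Ω u v = o * b * wOx (a + 1) b c := by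
    refine sum_sum_const_of_eq fun u hu v hv => ?_
    obtain ⟨huS, huS'⟩ := memO u hu
    obtain ⟨hvS, hvS'⟩ := mem_sdiff.1 hv
    have huv : u ≠ v := fun h => huS (h ▸ hvS)
    obtain ⟨t1, t2, t3⟩ := card3 u v huS hvS' huv
    rw [if_neg huS', if_pos hvS] at t1 t2 t3
    have huS2 : u ∉ insert v S' := fun h => by
      rcases mem_insert.1 h with h | h
      · exact huv h
      · exact huS' h
    rw [hΩ]; dsimp only
    have e2 : #(insert u S \ insert v S') = b := by omega
    have e3 : #(insert v S' \ insert u S) = c := by omega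
    rw [atomΩ_Ox _ _ _ _ _ huv huS2 (mem_insert_of_mem hvS), t1, e2, e3]
  have hOO : ∑ u ∈ V \ (S ∪ S'), ∑ v ∈ V \ (S ∪ S'), Ω u v = o * wJ (a + 1) b c + (o * o - o) * wOO a (b + 1) (c + 1) := by
    refine sum_sum_diag_of_eq (fun u hu => ?_) (fun u hu v hv huv => ?_)
    · obtain ⟨huS, huS'⟩ := memO u hu
      obtain ⟨t1, t2, t3⟩ := cardD u huS huS'
      rw [hΩ]; dsimp only; rw [atomΩ_J _ _ _ _ _ rfl, t1, t2, t3]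
    · obtain ⟨huS, huS'⟩ := memO u hu
      obtain ⟨hvS, hvS'⟩ := memO v hv
      obtain ⟨t1, t2, t3⟩ := card3 u v huS hvS' huv
      rw [if_neg huS', if_neg hvS] at t1 t2 t3
      have huS2 : u ∉ insert v S' := fun h => by
        rcases mem_insert.1 h with h | h
        · exact huv h
        · exact huS' h
      have hvS2 : v ∉ insert u S := fun h => by
        rcases mem_insert.1 h with h | h
        · exact huv h.symm
        · exact hvS h
      rw [hΩ]; dsimp only
      have e1 : a + 0 + 0 = a := by omega
      have e2 : #(insert u S \ insert v S') = b + 1 := by omega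
      have e3 : #(insert v S' \ insert u S) = c + 1 := by omega
      rw [atomΩ_OO _ _ _ _ _ huv huS2 hvS2, t1, e1, e2, e3]
  rw [hQP, hQO, hOP, hOO]
  ring

end Corners3

/-! ### The type-level identity and the certificate theorem -/

section Assembly
variable (wJ wX wOx wOz wOO : ℕ → ℕ → ℕ → ℚ)

omit [Fintype α] in
/-- **The weighted atom sum as a bilinear form**: `Σ_atoms Ω·Δx·Δz = Σ_{S,S' ⊆ V} [S ∈ 𝒳][S' ∈ 𝒵]·sepE(type of (S,S'))`. [this work] -/
theorem atomSum_eq_sum_sepE (F G : Finset (Finset α)) (V : Finset α) :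
    atomSum wJ wX wOx wOz wOO F G V = ∑ S ∈ V.powerset, ∑ S' ∈ V.powerset,
      ιq F S * ιq G S' * sepE wJ wX wOx wOz wOO #(S ∩ S') #(S \ S') #(S' \ S) #(V \ (S ∪ S')) := by
  set Ω : Finset α → α → Finset α → α → ℚ := atomΩ wJ wX wOx wOz wOO with hΩ
  -- expand the product of differences into the four corners
  have hexp : atomSum wJ wX wOx wOz wOO F G V =
      (∑ A ∈ V.powerset, ∑ u ∈ V \ A, ∑ B ∈ V.powerset, ∑ v ∈ V \ B, Ω (insert u A) u (insert v B) v * ιq F (insert u A) * ιq G (insert v B))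
      - (∑ A ∈ V.powerset, ∑ u ∈ V \ A, ∑ B ∈ V.powerset, ∑ v ∈ V \ B, Ω (insert u A) u (insert v B) v * ιq F (insert u A) * ιq G B)
      - (∑ A ∈ V.powerset, ∑ u ∈ V \ A, ∑ B ∈ V.powerset, ∑ v ∈ V \ B, Ω (insert u A) u (insert v B) v * ιq F A * ιq G (insert v B))
      + (∑ A ∈ V.powerset, ∑ u ∈ V \ A, ∑ B ∈ V.powerset, ∑ v ∈ V \ B, Ω (insert u A) u (insert v B) v * ιq F A * ιq G B) := by
    unfold atomSum
    simp only [← sum_sub_distrib, ← sum_add_distrib]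
    refine sum_congr rfl fun A _ => sum_congr rfl fun u _ => sum_congr rfl fun B _ => sum_congr rfl fun v _ => ?_
    rw [← hΩ]; ring
  -- corner 1: reindex both sides
  have h1 : ∑ A ∈ V.powerset, ∑ u ∈ V \ A, ∑ B ∈ V.powerset, ∑ v ∈ V \ B, Ω (insert u A) u (insert v B) v * ιq F (insert u A) * ιq G (insert v B)
      = ∑ S ∈ V.powerset, ∑ S' ∈ V.powerset, ιq F S * ιq G S' * ∑ u ∈ S, ∑ v ∈ S', Ω S u S' v := by
    rw [sum_powerset_sdiff_eq_sum_mem V (fun S u => ∑ B ∈ V.powerset, ∑ v ∈ V \ B, Ω S u (insert v B) v * ιq F S * ιq G (insert v B))]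
    refine sum_congr rfl fun S _ => ?_
    have : ∀ u, ∑ B ∈ V.powerset, ∑ v ∈ V \ B, Ω S u (insert v B) v * ιq F S * ιq G (insert v B)
        = ∑ S' ∈ V.powerset, ∑ v ∈ S', Ω S u S' v * ιq F S * ιq G S' := fun u =>
      sum_powerset_sdiff_eq_sum_mem V (fun S' v => Ω S u S' v * ιq F S * ιq G S')
    simp_rw [this]
    rw [sum_comm]
    refine sum_congr rfl fun S' _ => ?_
    rw [mul_sum]
    refine sum_congr rfl fun u _ => ?_
    rw [mul_sum]
    refine sum_congr rfl fun v _ => ?_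
    ring
  -- corner 2: reindex the x side only
  have h2 : ∑ A ∈ V.powerset, ∑ u ∈ V \ A, ∑ B ∈ V.powerset, ∑ v ∈ V \ B, Ω (insert u A) u (insert v B) v * ιq F (insert u A) * ιq G B
      = ∑ S ∈ V.powerset, ∑ S' ∈ V.powerset, ιq F S * ιq G S' * ∑ u ∈ S, ∑ v ∈ V \ S', Ω S u (insert v S') v := by
    rw [sum_powerset_sdiff_eq_sum_mem V (fun S u => ∑ B ∈ V.powerset, ∑ v ∈ V \ B, Ω S u (insert v B) v * ιq F S * ιq G B)]
    refine sum_congr rfl fun S _ => ?_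
    rw [sum_comm]
    refine sum_congr rfl fun S' _ => ?_
    rw [mul_sum]
    refine sum_congr rfl fun u _ => ?_
    rw [mul_sum]
    refine sum_congr rfl fun v _ => ?_
    ring
  -- corner 3: reindex the z side only
  have h3 : ∑ A ∈ V.powerset, ∑ u ∈ V \ A, ∑ B ∈ V.powerset, ∑ v ∈ V \ B, Ω (insert u A) u (insert v B) v * ιq F A * ιq G (insert v B)
      = ∑ S ∈ V.powerset, ∑ S' ∈ V.powerset, ιq F S * ιq G S' * ∑ u ∈ V \ S, ∑ v ∈ S', Ω (insert u S) u S' v := by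
    refine sum_congr rfl fun S _ => ?_
    have : ∀ u, ∑ B ∈ V.powerset, ∑ v ∈ V \ B, Ω (insert u S) u (insert v B) v * ιq F S * ιq G (insert v B)
        = ∑ S' ∈ V.powerset, ∑ v ∈ S', Ω (insert u S) u S' v * ιq F S * ιq G S' := fun u =>
      sum_powerset_sdiff_eq_sum_mem V (fun S' v => Ω (insert u S) u S' v * ιq F S * ιq G S')
    simp_rw [this]
    rw [sum_comm]
    refine sum_congr rfl fun S' _ => ?_
    rw [mul_sum]
    refine sum_congr rfl fun u _ => ?_
    rw [mul_sum]
    refine sum_congr rfl fun v _ => ?_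
    ring
  -- corner 4: no reindexing
  have h4 : ∑ A ∈ V.powerset, ∑ u ∈ V \ A, ∑ B ∈ V.powerset, ∑ v ∈ V \ B, Ω (insert u A) u (insert v B) v * ιq F A * ιq G B
      = ∑ S ∈ V.powerset, ∑ S' ∈ V.powerset, ιq F S * ιq G S' * ∑ u ∈ V \ S, ∑ v ∈ V \ S', Ω (insert u S) u (insert v S') v := by
    refine sum_congr rfl fun S _ => ?_
    rw [sum_comm]
    refine sum_congr rfl fun S' _ => ?_
    rw [mul_sum]
    refine sum_congr rfl fun u _ => ?_
    rw [mul_sum]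
    refine sum_congr rfl fun v _ => ?_
    ring
  rw [hexp, h1, h2, h3, h4, ← sum_sub_distrib, ← sum_sub_distrib, ← sum_add_distrib]
  refine sum_congr rfl fun S hS => ?_
  rw [← sum_sub_distrib, ← sum_sub_distrib, ← sum_add_distrib]
  refine sum_congr rfl fun S' hS' => ?_
  have hSV : S ⊆ V := mem_powerset.1 hS
  have hS'V : S' ⊆ V := mem_powerset.1 hS'
  rw [hΩ, corner_one, corner_two wJ wX wOx wOz wOO V S S' hSV, corner_three wJ wX wOx wOz wOO V S S' hS'V,
    corner_four wJ wX wOx wOz wOO V S S' hSV hS'V]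
  unfold sepE
  ring

end Assembly

end Summit.CriticalPhenomena.PercolationContinuityZ3.Theorems.SahiCTCForms
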